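import Summits.KontsevichZagierPeriods.KontsevichZagierPeriods.Theorems.HurwitzMicroSectorsNormalFormPrincipleW3PowerSubstitution
import Summits.KontsevichZagierPeriods.KontsevichZagierPeriods.Theorems.HurwitzMicroSectorsNormalFormPrincipleW3MergeAndPerm
import Summits.KontsevichZagierPeriods.KontsevichZagierPeriods.Theorems.HurwitzMicroSectorsNormalFormPrincipleW3Reband
import Summits.KontsevichZagierPeriods.KontsevichZagierPeriods.Theorems.HurwitzMicroSectorsNormalFormPrincipleW3Stokes
import Summits.KontsevichZagierPeriods.KontsevichZagierPeriods.Theorems.HurwitzMicroSectorsNormalFormPrincipleW3ExistsBoxBand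
import Summits.KontsevichZagierPeriods.KontsevichZagierPeriods.Theorems.HurwitzMicroSectorsNormalFormPrincipleW3ExistsNestedBase
import Summits.KontsevichZagierPeriods.KontsevichZagierPeriods.Theorems.HurwitzMicroSectorsNormalFormPrincipleLevelKTriangleSubDimOne
import Summits.KontsevichZagierPeriods.KontsevichZagierPeriods.Theorems.HurwitzMicroSectorsNormalFormPrincipleLevelKExistsReps
import Summits.KontsevichZagierPeriods.KontsevichZagierPeriods.Theorems.HurwitzMicroSectorsNormalFormPrincipleLevelKDimOneIsRational
import Summits.KontsevichZagierPeriods.KontsevichZagierPeriods.Theorems.HurwitzMicroSectorsNormalFormPrincipleDimOneAssembly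

/-!
# `NormalFormPrinciple` (stmt-KontsevichZagierPeriods-3869), line `SketchIdeator1` — leaf `stub_boxRigidity`:
# WEIGHT THREE, ALL LEVELS, TOTALLY OFF RESONANCE: Conjecture 1 (kernel form), unconditionally

Boxes `[(0,1)³, c x^a y^b z^d/(1 − x^{k₁} y^{k₂} z^{k₃})]`, `c ∈ ℚ`, `kᵢ ≥ 1`, whose resonance parameters
`θ₁ = (a+1)/k₁`, `θ₂ = (b+1)/k₂`, `θ₃ = (d+1)/k₃` are PAIRWISE DISTINCT. Their values
`Σ_n c/(k₁k₂k₃·Π(n+θᵢ))` are `ℚ`-combinations of digamma values at rationals (partial fractions), i.e.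
lie in the Baker module `ℚ̄ + ℚ̄π + Σ ℚ̄ log ℚ̄`; when two `θ`'s coincide a `ζ(2,θ)`-term appears and
mixes with the logarithms (independence open) — hence "totally off resonance".

Chain of moves per box: power substitution `(X,Y,Z) ↦ (X^{k₂k₃}, Y^{k₁k₃}, Z^{k₁k₂})` (rule 2,
`power_substitution3`) to the level `K = k₁k₂k₃` in all coordinates, exponents `A, B, D` pairwise
distinct; at most three transpositions of coordinates (rule 2, `merge3_and_perm`) sort them as
`D < B < A`; the merge `t = xyz` for fixed `(x,y)` (rule 2, affine in the last coordinate,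
`merge3_and_perm`) gives the band `{(x,y) ∈ (0,1)², 0 ≤ t ≤ xy}` with integrand
`c x^{A−D−1} y^{B−D−1} t^D/(1 − t^K)`; the coordinate permutation `(x,y,t) ↦ (x,t,y)` re-bands it as
`{0<x<1, 0≤t≤x} × {t/x ≤ y ≤ 1}` (rule 2 + null sets, `reband3`); integrating out `y` (rule 3,
`stokes3`) lands on the level-`K` triangle with integrand `(c/E)(x^{A−D−1}t^D − x^{A−B−1}t^B)/(1−t^K)`,
`E = B − D`, which splits (rule 1) into two level-`K` triangle representations of wave 8; each goes to
a RATIONAL representation of dimension one (`LevelK.levelK_triangle_sub_dimOne`,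
`LevelK.levelK_dimOne_isRational`). Hence the subgroup generated by these boxes and all rational
representations of dimension `≤ 1` is congruent modulo relations to the latter, where seat c4's
kernel theorem (`Dlog.mem_relations_of_eval_eq_zero_of_dim_le_one`, Baker) applies:
CONJECTURE 1 OF KONTSEVICH–ZAGIER HOLDS, IN KERNEL FORM, ON THIS WEIGHT-THREE LAYER UNCONDITIONALLY
(`offres3_mem_relations_of_eval_eq_zero_of_mem_closure`); e.g.
`∫∫∫_{(0,1)³} y z³ dxdydz/(1 − xyz) = Σ_n 1/((n+1)(n+2)(n+4)) = 7/36` against the rational point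
`[pt, 7/36]` (`offres3_equivalent_dimLeOne_of_value_eq`).
References: M. Kontsevich, D. Zagier, *Periods* (2001), §1.2 Conjecture 1; A. Baker, *Transcendental
Number Theory* (1975), Thm. 2.1 (as landed in the tree). No new definitions.
-/

noncomputable section

open MeasureTheory Set
open Literature.NumberTheory.Transcendental Literature.NumberTheory.Transcendental.KZ
open Literature.ModelTheory.ExponentialFields (IsSemialgebraic)

namespace Summit.KontsevichZagierPeriods.HurwitzMicroSectors.NormalFormPrinciple.PiBox.Weight3


open Summit.KontsevichZagierPeriods.HurwitzMicroSectors.NormalFormPrinciple.PiBox.Dlog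
  (mem_relations_of_eval_eq_zero_of_dim_le_one)
open Summit.KontsevichZagierPeriods.HurwitzMicroSectors.NormalFormPrinciple.PiBox.LevelK
  (levelK_triangle_sub_dimOne levelK_exists_reps levelK_dimOne_isRational)

/-- **Sorted case `D < B < A`**: the level-`K` weight-three monomial box reduces to the difference of
two RATIONAL representations of dimension one (merge → re-band → integrate out `y` → split → two
level-`K` triangles → integrate out `x`). [cite: KontsevichZagier2001, §1.2] -/
theorem sorted3_sub_dimOne (K : ℕ) (hK : 0 < K) (A B D : ℕ) (hDB : D < B) (hBA : B < A) (c : ℚ)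
    (N : IntegralRep 3) (hNd : N.domain = {x | ∀ i, x i ∈ Set.Ioo (0:ℝ) 1})
    (hNi : EqOn N.integrand (fun x => (c : ℝ) * (x 0 ^ A * x 1 ^ B * x 2 ^ D) /
      (1 - x 0 ^ K * x 1 ^ K * x 2 ^ K)) N.domain) :
    ∃ N₁ N₂ : IntegralRep 1, N₁.IsRational ∧ N₂.IsRational ∧ of N - (of N₁ - of N₂) ∈ relations := by
  have hc : IsAlgebraic ℚ (c : ℝ) := isAlgebraic_algebraMap c
  have hE : 0 < B - D := by omega
  have hEA : B - D ≤ A - D - 1 := by omega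
  have hcE : IsAlgebraic ℚ ((c / (B - D : ℕ) : ℚ) : ℝ) := isAlgebraic_algebraMap _
  have hcE' : ((c / (B - D : ℕ) : ℚ) : ℝ) = (c : ℝ) / ((B - D : ℕ) : ℝ) := by push_cast; rfl
  -- the representations
  obtain ⟨-, hexR⟩ := exists_reps3_box_band K hK (c : ℝ) hc
  obtain ⟨hexR', hexT⟩ := exists_reps3_nested_base K hK (c : ℝ) hc
  obtain ⟨R, hRd, hRi⟩ := hexR (A - D - 1) (B - D - 1) D
  obtain ⟨R', hR'd, hR'i⟩ := hexR' (A - D - 1) (B - D - 1) D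
  obtain ⟨T, hTd, hTi⟩ := hexT (A - D - 1) D (B - D) hEA
  obtain ⟨-, hexTK, hexN₁K⟩ := levelK_exists_reps K hK ((c / (B - D : ℕ) : ℚ) : ℝ) hcE
  obtain ⟨T₁, hT₁d, hT₁i⟩ := hexTK A D (by omega)
  obtain ⟨T₂, hT₂d, hT₂i⟩ := hexTK A B hBA
  obtain ⟨N₁, hN₁d, hN₁i⟩ := hexN₁K A D
  obtain ⟨N₂, hN₂d, hN₂i⟩ := hexN₁K A B
  -- the moves in dimension three
  have e1 := (merge3_and_perm K hK A B D (c : ℝ) hc).1 (by omega) hDB N R hNd hNi hRd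
    (hRi ▸ fun _ _ => rfl)
  have e2 := reband3 K hK (A - D - 1) (B - D - 1) D (c : ℝ) hc R R' hRd (hRi ▸ fun _ _ => rfl) hR'd
    (hR'i ▸ fun _ _ => rfl)
  have hBE : B - D - 1 = B - D - 1 := rfl
  have e3 := stokes3 K hK (A - D - 1) D (B - D) hE hEA (c : ℝ) hc R' T hR'd
    (fun z _ => by rw [hR'i]) hTd (hTi ▸ fun _ _ => rfl)
  -- split `T₁ = T + T₂` on the level-K triangle (integrand additivity)
  have hA1 : A - D - 1 - (B - D) = A - B - 1 := by omega
  have hA2 : D + (B - D) = B := by omega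
  have e4 : of T₁ - of T - of T₂ ∈ relations := by
    refine integrandAddRel_subset_relations ⟨2, T₁, T, T₂, hTd.trans hT₁d.symm, hT₂d.trans hT₁d.symm,
      fun w _ => ?_, rfl⟩
    rw [Pi.add_apply, hT₁i, hTi, hT₂i, hA1, hA2, hcE']
    ring
  -- the two triangles go to dimension one (wave 8)
  have e5 := levelK_triangle_sub_dimOne K hK A D _ hcE (by omega) T₁ N₁ hT₁d (hT₁i ▸ fun _ _ => rfl)
    hN₁d (hN₁i ▸ fun _ _ => rfl)
  have e6 := levelK_triangle_sub_dimOne K hK A B _ hcE hBA T₂ N₂ hT₂d (hT₂i ▸ fun _ _ => rfl)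
    hN₂d (hN₂i ▸ fun _ _ => rfl)
  refine ⟨N₁, N₂, levelK_dimOne_isRational K hK A D (c / (B - D : ℕ)) N₁ hN₁d (fun x _ => by rw [hN₁i]),
    levelK_dimOne_isRational K hK A B (c / (B - D : ℕ)) N₂ hN₂d (fun x _ => by rw [hN₂i]), ?_⟩
  have e : of N - (of N₁ - of N₂) = (of N - of R) + (of R - of R') + (of R' - of T)
      - (of T₁ - of T - of T₂) + (of T₁ - of N₁) - (of T₂ - of N₂) := by abel
  rw [e]
  exact relations.sub_mem (relations.add_mem (relations.sub_mem (relations.add_mem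
    (relations.add_mem e1 e2) e3) e4) e5) e6

/-- Transposition of the first two exponents (rule 2). [cite: KontsevichZagier2001, §1.2 rule (2)] -/
theorem perm₁_step (K : ℕ) (hK : 0 < K) (A B D : ℕ) (c : ℚ) (N : IntegralRep 3)
    (hNd : N.domain = {x | ∀ i, x i ∈ Set.Ioo (0:ℝ) 1})
    (hNi : EqOn N.integrand (fun x => (c : ℝ) * (x 0 ^ A * x 1 ^ B * x 2 ^ D) /
      (1 - x 0 ^ K * x 1 ^ K * x 2 ^ K)) N.domain) :
    ∃ N' : IntegralRep 3, N'.domain = {x | ∀ i, x i ∈ Set.Ioo (0:ℝ) 1} ∧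
      EqOn N'.integrand (fun x => (c : ℝ) * (x 0 ^ B * x 1 ^ A * x 2 ^ D) /
        (1 - x 0 ^ K * x 1 ^ K * x 2 ^ K)) N'.domain ∧ of N - of N' ∈ relations := by
  have hc : IsAlgebraic ℚ (c : ℝ) := isAlgebraic_algebraMap c
  obtain ⟨hexN, -⟩ := exists_reps3_box_band K hK (c : ℝ) hc
  obtain ⟨N', hN'd, hN'i⟩ := hexN B A D
  exact ⟨N', hN'd, hN'i ▸ fun _ _ => rfl,
    (merge3_and_perm K hK A B D (c : ℝ) hc).2.1 N N' hNd hNi hN'd (hN'i ▸ fun _ _ => rfl)⟩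

/-- Transposition of the last two exponents (rule 2). [cite: KontsevichZagier2001, §1.2 rule (2)] -/
theorem perm₂_step (K : ℕ) (hK : 0 < K) (A B D : ℕ) (c : ℚ) (N : IntegralRep 3)
    (hNd : N.domain = {x | ∀ i, x i ∈ Set.Ioo (0:ℝ) 1})
    (hNi : EqOn N.integrand (fun x => (c : ℝ) * (x 0 ^ A * x 1 ^ B * x 2 ^ D) /
      (1 - x 0 ^ K * x 1 ^ K * x 2 ^ K)) N.domain) :
    ∃ N' : IntegralRep 3, N'.domain = {x | ∀ i, x i ∈ Set.Ioo (0:ℝ) 1} ∧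
      EqOn N'.integrand (fun x => (c : ℝ) * (x 0 ^ A * x 1 ^ D * x 2 ^ B) /
        (1 - x 0 ^ K * x 1 ^ K * x 2 ^ K)) N'.domain ∧ of N - of N' ∈ relations := by
  have hc : IsAlgebraic ℚ (c : ℝ) := isAlgebraic_algebraMap c
  obtain ⟨hexN, -⟩ := exists_reps3_box_band K hK (c : ℝ) hc
  obtain ⟨N', hN'd, hN'i⟩ := hexN A D B
  exact ⟨N', hN'd, hN'i ▸ fun _ _ => rfl,
    (merge3_and_perm K hK A B D (c : ℝ) hc).2.2 N N' hNd hNi hN'd (hN'i ▸ fun _ _ => rfl)⟩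

/-- **Pairwise distinct exponents, any order**: sort by at most three transpositions, then
`sorted3_sub_dimOne`. [cite: KontsevichZagier2001, §1.2] -/
theorem distinct3_sub_dimOne (K : ℕ) (hK : 0 < K) (A B D : ℕ) (hAB : A ≠ B) (hAD : A ≠ D)
    (hBD : B ≠ D) (c : ℚ) (N : IntegralRep 3) (hNd : N.domain = {x | ∀ i, x i ∈ Set.Ioo (0:ℝ) 1})
    (hNi : EqOn N.integrand (fun x => (c : ℝ) * (x 0 ^ A * x 1 ^ B * x 2 ^ D) /
      (1 - x 0 ^ K * x 1 ^ K * x 2 ^ K)) N.domain) :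
    ∃ N₁ N₂ : IntegralRep 1, N₁.IsRational ∧ N₂.IsRational ∧ of N - (of N₁ - of N₂) ∈ relations := by
  -- glue: a step `of N − of N' ∈ relations` transports the conclusion from `N'` to `N`
  have glue : ∀ (N M : IntegralRep 3), of N - of M ∈ relations →
      (∃ N₁ N₂ : IntegralRep 1, N₁.IsRational ∧ N₂.IsRational ∧ of M - (of N₁ - of N₂) ∈ relations) →
      ∃ N₁ N₂ : IntegralRep 1, N₁.IsRational ∧ N₂.IsRational ∧ of N - (of N₁ - of N₂) ∈ relations := by
    intro N M e ⟨N₁, N₂, h₁, h₂, e'⟩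
    refine ⟨N₁, N₂, h₁, h₂, ?_⟩
    have ee : of N - (of N₁ - of N₂) = (of N - of M) + (of M - (of N₁ - of N₂)) := by abel
    rw [ee]
    exact relations.add_mem e e'
  rcases Nat.lt_or_gt_of_ne hAB with hAB | hBA
  · rcases Nat.lt_or_gt_of_ne hAD with hAD | hDA
    · rcases Nat.lt_or_gt_of_ne hBD with hBD | hDB
      · -- A < B < D : τ₁, τ₂, τ₁ → (D, B, A)
        obtain ⟨Na, hNad, hNai, ea⟩ := perm₁_step K hK A B D c N hNd hNi
        obtain ⟨Nb, hNbd, hNbi, eb⟩ := perm₂_step K hK B A D c Na hNad hNai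
        obtain ⟨Nc, hNcd, hNci, ec⟩ := perm₁_step K hK B D A c Nb hNbd hNbi
        exact glue N Na ea (glue Na Nb eb (glue Nb Nc ec
          (sorted3_sub_dimOne K hK D B A hAB hBD c Nc hNcd hNci)))
      · -- A < D < B : τ₁ → (B, A, D), τ₂ → (B, D, A)
        obtain ⟨Na, hNad, hNai, ea⟩ := perm₁_step K hK A B D c N hNd hNi
        obtain ⟨Nb, hNbd, hNbi, eb⟩ := perm₂_step K hK B A D c Na hNad hNai
        exact glue N Na ea (glue Na Nb eb (sorted3_sub_dimOne K hK B D A hAD hDB c Nb hNbd hNbi))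
    · -- D < A < B : τ₁ → (B, A, D)
      obtain ⟨Na, hNad, hNai, ea⟩ := perm₁_step K hK A B D c N hNd hNi
      exact glue N Na ea (sorted3_sub_dimOne K hK B A D hDA hAB c Na hNad hNai)
  · rcases Nat.lt_or_gt_of_ne hBD with hBD | hDB
    · rcases Nat.lt_or_gt_of_ne hAD with hAD | hDA
      · -- B < A < D : τ₂ → (A, D, B), τ₁ → (D, A, B)
        obtain ⟨Na, hNad, hNai, ea⟩ := perm₂_step K hK A B D c N hNd hNi
        obtain ⟨Nb, hNbd, hNbi, eb⟩ := perm₁_step K hK A D B c Na hNad hNai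
        exact glue N Na ea (glue Na Nb eb (sorted3_sub_dimOne K hK D A B hBA hAD c Nb hNbd hNbi))
      · -- B < D < A : τ₂ → (A, D, B)
        obtain ⟨Na, hNad, hNai, ea⟩ := perm₂_step K hK A B D c N hNd hNi
        exact glue N Na ea (sorted3_sub_dimOne K hK A D B hBD hDA c Na hNad hNai)
    · -- D < B < A : sorted
      exact sorted3_sub_dimOne K hK A B D hDB hBA c N hNd hNi

/-- **Totally off resonance, any levels `(k₁, k₂, k₃)`**: the box
`[(0,1)³, c x^a y^b z^d/(1 − x^{k₁} y^{k₂} z^{k₃})]` with pairwise distinct `θᵢ` differs by a relation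
from a difference of two rational representations of dimension one. [cite: KontsevichZagier2001, §1.2] -/
theorem offres3_sub_dimOne (k₁ k₂ k₃ : ℕ) (hk₁ : 0 < k₁) (hk₂ : 0 < k₂) (hk₃ : 0 < k₃) (a b d : ℕ)
    (h₁₂ : (a + 1) * k₂ ≠ (b + 1) * k₁) (h₁₃ : (a + 1) * k₃ ≠ (d + 1) * k₁)
    (h₂₃ : (b + 1) * k₃ ≠ (d + 1) * k₂) (c : ℚ) (N : IntegralRep 3)
    (hNd : N.domain = {x | ∀ i, x i ∈ Set.Ioo (0:ℝ) 1})
    (hNi : EqOn N.integrand (fun x => (c : ℝ) * (x 0 ^ a * x 1 ^ b * x 2 ^ d) /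
      (1 - x 0 ^ k₁ * x 1 ^ k₂ * x 2 ^ k₃)) N.domain) :
    ∃ N₁ N₂ : IntegralRep 1, N₁.IsRational ∧ N₂.IsRational ∧ of N - (of N₁ - of N₂) ∈ relations := by
  have hc : IsAlgebraic ℚ (c : ℝ) := isAlgebraic_algebraMap c
  have hK : 0 < k₁ * k₂ * k₃ := Nat.mul_pos (Nat.mul_pos hk₁ hk₂) hk₃
  -- power substitution with `m = (k₂k₃, k₁k₃, k₁k₂)`
  obtain ⟨hexN, -⟩ := exists_reps3_box_band (k₁ * k₂ * k₃) hK
    ((c * (k₂ * k₃ * (k₁ * k₃) * (k₁ * k₂) : ℕ) : ℚ) : ℝ) (isAlgebraic_algebraMap _)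
  obtain ⟨N', hN'd, hN'i⟩ := hexN ((a + 1) * (k₂ * k₃) - 1) ((b + 1) * (k₁ * k₃) - 1)
    ((d + 1) * (k₁ * k₂) - 1)
  have e0 := power_substitution3 (k₂ * k₃) (k₁ * k₃) (k₁ * k₂) (Nat.mul_pos hk₂ hk₃)
    (Nat.mul_pos hk₁ hk₃) (Nat.mul_pos hk₁ hk₂) k₁ k₂ k₃ hk₁ hk₂ hk₃ (c : ℝ) hc a b d N N' hNd hNi hN'd
    (fun x _ => by
      rw [hN'i]
      have e1 : k₁ * (k₂ * k₃) = k₁ * k₂ * k₃ := by ring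
      have e2 : k₂ * (k₁ * k₃) = k₁ * k₂ * k₃ := by ring
      have e3 : k₃ * (k₁ * k₂) = k₁ * k₂ * k₃ := by ring
      rw [e1, e2, e3]
      push_cast
      ring)
  -- the new exponents are pairwise distinct
  have hA : 0 < (a + 1) * (k₂ * k₃) := Nat.mul_pos (Nat.succ_pos a) (Nat.mul_pos hk₂ hk₃)
  have hB : 0 < (b + 1) * (k₁ * k₃) := Nat.mul_pos (Nat.succ_pos b) (Nat.mul_pos hk₁ hk₃)
  have hD : 0 < (d + 1) * (k₁ * k₂) := Nat.mul_pos (Nat.succ_pos d) (Nat.mul_pos hk₁ hk₂)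
  have hAB : (a + 1) * (k₂ * k₃) - 1 ≠ (b + 1) * (k₁ * k₃) - 1 := by
    intro h
    apply h₁₂
    have h' : (a + 1) * (k₂ * k₃) = (b + 1) * (k₁ * k₃) := by omega
    have h'' : (a + 1) * k₂ * k₃ = (b + 1) * k₁ * k₃ := by
      rw [Nat.mul_assoc, Nat.mul_assoc]; exact h'
    exact Nat.eq_of_mul_eq_mul_right hk₃ h''
  have hAD : (a + 1) * (k₂ * k₃) - 1 ≠ (d + 1) * (k₁ * k₂) - 1 := by
    intro h
    apply h₁₃
    have h' : (a + 1) * (k₂ * k₃) = (d + 1) * (k₁ * k₂) := by omega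
    have h'' : (a + 1) * k₃ * k₂ = (d + 1) * k₁ * k₂ := by
      calc (a + 1) * k₃ * k₂ = (a + 1) * (k₂ * k₃) := by ring
        _ = (d + 1) * (k₁ * k₂) := h'
        _ = (d + 1) * k₁ * k₂ := by ring
    exact Nat.eq_of_mul_eq_mul_right hk₂ h''
  have hBD : (b + 1) * (k₁ * k₃) - 1 ≠ (d + 1) * (k₁ * k₂) - 1 := by
    intro h
    apply h₂₃
    have h' : (b + 1) * (k₁ * k₃) = (d + 1) * (k₁ * k₂) := by omega
    have h'' : (b + 1) * k₃ * k₁ = (d + 1) * k₂ * k₁ := by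
      calc (b + 1) * k₃ * k₁ = (b + 1) * (k₁ * k₃) := by ring
        _ = (d + 1) * (k₁ * k₂) := h'
        _ = (d + 1) * k₂ * k₁ := by ring
    exact Nat.eq_of_mul_eq_mul_right hk₁ h''
  obtain ⟨N₁, N₂, h₁, h₂, e⟩ := distinct3_sub_dimOne (k₁ * k₂ * k₃) hK _ _ _ hAB hAD hBD _ N' hN'd
    (fun x _ => by rw [hN'i])
  refine ⟨N₁, N₂, h₁, h₂, ?_⟩
  have ee : of N - (of N₁ - of N₂) = (of N - of N') + (of N' - (of N₁ - of N₂)) := by abel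
  rw [ee]
  exact relations.add_mem e0 e

/-- Every element of the subgroup generated by the totally-off-resonance weight-three boxes and the
rational representations of dimension `≤ 1` is congruent modulo relations to an element of the subgroup
generated by the latter alone. [cite: KontsevichZagier2001, §1.2] -/
theorem exists_mem_dimLeOneClosure_of_mem_offres3Closure {x : FormalRep}
    (hx : x ∈ AddSubgroup.closure
      ({y : FormalRep | ∃ (k₁ k₂ k₃ a b d : ℕ) (c : ℚ) (N : IntegralRep 3), 0 < k₁ ∧ 0 < k₂ ∧ 0 < k₃ ∧
          (a + 1) * k₂ ≠ (b + 1) * k₁ ∧ (a + 1) * k₃ ≠ (d + 1) * k₁ ∧ (b + 1) * k₃ ≠ (d + 1) * k₂ ∧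
          N.domain = {x | ∀ i, x i ∈ Set.Ioo (0:ℝ) 1} ∧
          EqOn N.integrand (fun x => (c : ℝ) * (x 0 ^ a * x 1 ^ b * x 2 ^ d) /
            (1 - x 0 ^ k₁ * x 1 ^ k₂ * x 2 ^ k₃)) N.domain ∧ y = of N} ∪
       {y : FormalRep | ∃ (m : ℕ) (N : IntegralRep m), m ≤ 1 ∧ N.IsRational ∧ y = of N})) :
    ∃ x' ∈ AddSubgroup.closure
        {y : FormalRep | ∃ (m : ℕ) (N : IntegralRep m), m ≤ 1 ∧ N.IsRational ∧ y = of N},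
      x - x' ∈ relations := by
  induction hx using AddSubgroup.closure_induction with
  | mem y hy =>
    rcases hy with hy | hy
    · obtain ⟨k₁, k₂, k₃, a, b, d, c, N, hk₁, hk₂, hk₃, h₁₂, h₁₃, h₂₃, hNd, hNi, rfl⟩ := hy
      obtain ⟨N₁, N₂, h₁, h₂, e⟩ := offres3_sub_dimOne k₁ k₂ k₃ hk₁ hk₂ hk₃ a b d h₁₂ h₁₃ h₂₃ c N hNd hNi
      exact ⟨of N₁ - of N₂, AddSubgroup.sub_mem _ (AddSubgroup.subset_closure ⟨1, N₁, le_rfl, h₁, rfl⟩)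
        (AddSubgroup.subset_closure ⟨1, N₂, le_rfl, h₂, rfl⟩), e⟩
    · exact ⟨y, AddSubgroup.subset_closure hy, by simp [relations.zero_mem]⟩
  | zero => exact ⟨0, AddSubgroup.zero_mem _, by simp [relations.zero_mem]⟩
  | add y z _ _ ihy ihz =>
    obtain ⟨y', hy', ey⟩ := ihy
    obtain ⟨z', hz', ez⟩ := ihz
    refine ⟨y' + z', AddSubgroup.add_mem _ hy' hz', ?_⟩
    have e : y + z - (y' + z') = (y - y') + (z - z') := by abel
    rw [e]
    exact relations.add_mem ey ez
  | neg y _ ihy =>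
    obtain ⟨y', hy', ey⟩ := ihy
    refine ⟨-y', AddSubgroup.neg_mem _ hy', ?_⟩
    have e : -y - -y' = -(y - y') := by abel
    rw [e]
    exact relations.neg_mem ey

/-- **Conjecture 1 of Kontsevich–Zagier, kernel form, for WEIGHT THREE TOTALLY OFF RESONANCE, ALL
LEVELS** — unconditionally: a formal `ℤ`-combination of boxes
`[(0,1)³, c x^a y^b z^d/(1 − x^{k₁}y^{k₂}z^{k₃})]` (`c ∈ ℚ`, `kᵢ ≥ 1`, `θᵢ = (eᵢ+1)/kᵢ` pairwise distinct)
and of rational representations of dimension `≤ 1`, with value `0`, is a relation (rules 2, 2, 2, 3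
into the level-`K` triangle, rule 3 again into dimension one, then Baker — seat c4's
`Dlog.mem_relations_of_eval_eq_zero_of_dim_le_one`). [cite: KontsevichZagier2001, §1.2 Conjecture 1] -/
theorem offres3_mem_relations_of_eval_eq_zero_of_mem_closure {x : FormalRep}
    (hx : x ∈ AddSubgroup.closure
      ({y : FormalRep | ∃ (k₁ k₂ k₃ a b d : ℕ) (c : ℚ) (N : IntegralRep 3), 0 < k₁ ∧ 0 < k₂ ∧ 0 < k₃ ∧
          (a + 1) * k₂ ≠ (b + 1) * k₁ ∧ (a + 1) * k₃ ≠ (d + 1) * k₁ ∧ (b + 1) * k₃ ≠ (d + 1) * k₂ ∧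
          N.domain = {x | ∀ i, x i ∈ Set.Ioo (0:ℝ) 1} ∧
          EqOn N.integrand (fun x => (c : ℝ) * (x 0 ^ a * x 1 ^ b * x 2 ^ d) /
            (1 - x 0 ^ k₁ * x 1 ^ k₂ * x 2 ^ k₃)) N.domain ∧ y = of N} ∪
       {y : FormalRep | ∃ (m : ℕ) (N : IntegralRep m), m ≤ 1 ∧ N.IsRational ∧ y = of N}))
    (hv : eval x = 0) : x ∈ relations := by
  obtain ⟨x', hx', e⟩ := exists_mem_dimLeOneClosure_of_mem_offres3Closure hx
  have h0 : eval x' = 0 := by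
    have h := relations_le_ker_eval_holds e
    rw [AddMonoidHom.mem_ker, map_sub, hv, zero_sub, neg_eq_zero] at h
    exact h
  have hx'r := mem_relations_of_eval_eq_zero_of_dim_le_one hx' h0
  have e' : x = (x - x') + x' := by abel
  rw [e']
  exact relations.add_mem e hx'r

/-- **A totally-off-resonance weight-three box against ANY rational representation of dimension
`≤ 1`** — e.g. `∫∫∫_{(0,1)³} y z³ dxdydz/(1 − xyz) = Σ_n 1/((n+1)(n+2)(n+4)) = 7/36` against the rational
point `[pt, 7/36]`: equal values imply KZ-equivalence, unconditionally.
[cite: KontsevichZagier2001, §1.2 Conjecture 1] -/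
theorem offres3_equivalent_dimLeOne_of_value_eq {m : ℕ} (hm : m ≤ 1) (k₁ k₂ k₃ a b d : ℕ) (c : ℚ)
    (hk₁ : 0 < k₁) (hk₂ : 0 < k₂) (hk₃ : 0 < k₃) (h₁₂ : (a + 1) * k₂ ≠ (b + 1) * k₁)
    (h₁₃ : (a + 1) * k₃ ≠ (d + 1) * k₁) (h₂₃ : (b + 1) * k₃ ≠ (d + 1) * k₂)
    (N : IntegralRep 3) (M : IntegralRep m) (hM : M.IsRational)
    (hNd : N.domain = {x | ∀ i, x i ∈ Set.Ioo (0:ℝ) 1})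
    (hNi : EqOn N.integrand (fun x => (c : ℝ) * (x 0 ^ a * x 1 ^ b * x 2 ^ d) /
      (1 - x 0 ^ k₁ * x 1 ^ k₂ * x 2 ^ k₃)) N.domain)
    (hv : N.value = M.value) : Equivalent N M := by
  refine offres3_mem_relations_of_eval_eq_zero_of_mem_closure (AddSubgroup.sub_mem _
    (AddSubgroup.subset_closure (Or.inl ⟨k₁, k₂, k₃, a, b, d, c, N, hk₁, hk₂, hk₃, h₁₂, h₁₃, h₂₃, hNd,
      hNi, rfl⟩))
    (AddSubgroup.subset_closure (Or.inr ⟨m, M, hm, hM, rfl⟩))) ?_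
  rw [map_sub, eval_of, eval_of, hv, sub_self]

/-- **Two totally-off-resonance weight-three boxes with equal values are KZ-equivalent**
(unconditionally). [cite: KontsevichZagier2001, §1.2 Conjecture 1] -/
theorem offres3_equivalent_of_value_eq (k₁ k₂ k₃ a b d k₁' k₂' k₃' a' b' d' : ℕ) (c c' : ℚ)
    (hk₁ : 0 < k₁) (hk₂ : 0 < k₂) (hk₃ : 0 < k₃) (h₁₂ : (a + 1) * k₂ ≠ (b + 1) * k₁)
    (h₁₃ : (a + 1) * k₃ ≠ (d + 1) * k₁) (h₂₃ : (b + 1) * k₃ ≠ (d + 1) * k₂)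
    (hk₁' : 0 < k₁') (hk₂' : 0 < k₂') (hk₃' : 0 < k₃') (h₁₂' : (a' + 1) * k₂' ≠ (b' + 1) * k₁')
    (h₁₃' : (a' + 1) * k₃' ≠ (d' + 1) * k₁') (h₂₃' : (b' + 1) * k₃' ≠ (d' + 1) * k₂')
    (N N' : IntegralRep 3) (hNd : N.domain = {x | ∀ i, x i ∈ Set.Ioo (0:ℝ) 1})
    (hNi : EqOn N.integrand (fun x => (c : ℝ) * (x 0 ^ a * x 1 ^ b * x 2 ^ d) /
      (1 - x 0 ^ k₁ * x 1 ^ k₂ * x 2 ^ k₃)) N.domain)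
    (hN'd : N'.domain = {x | ∀ i, x i ∈ Set.Ioo (0:ℝ) 1})
    (hN'i : EqOn N'.integrand (fun x => (c' : ℝ) * (x 0 ^ a' * x 1 ^ b' * x 2 ^ d') /
      (1 - x 0 ^ k₁' * x 1 ^ k₂' * x 2 ^ k₃')) N'.domain)
    (hv : N.value = N'.value) : Equivalent N N' := by
  refine offres3_mem_relations_of_eval_eq_zero_of_mem_closure (AddSubgroup.sub_mem _
    (AddSubgroup.subset_closure (Or.inl ⟨k₁, k₂, k₃, a, b, d, c, N, hk₁, hk₂, hk₃, h₁₂, h₁₃, h₂₃, hNd,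
      hNi, rfl⟩))
    (AddSubgroup.subset_closure (Or.inl ⟨k₁', k₂', k₃', a', b', d', c', N', hk₁', hk₂', hk₃', h₁₂', h₁₃',
      h₂₃', hN'd, hN'i, rfl⟩))) ?_
  rw [map_sub, eval_of, eval_of, hv, sub_self]

end Summit.KontsevichZagierPeriods.HurwitzMicroSectors.NormalFormPrinciple.PiBox.Weight3
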